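import Summits.NavierStokesRegularity.NavierStokesRegularity.Theses.AdaptedFrequency
import Literature.Analysis.FluidPDE.AdaptedBackwardKernel
import Literature.Analysis.FluidPDE.DriftHeatKernelLowerBound
import Literature.Analysis.FluidPDE.DriftHeatKernelWindow
import Literature.Analysis.FluidPDE.DriftHeatInteriorLipschitz
import Literature.Analysis.FluidPDE.ForcedHeatDuhamelTime

/-!
# Line `nash-entropy-last-block` for crux `AdaptedKernelExists` (stmt-NavierStokesRegularity-2956) — gen 3 (lead reshape)

Skeleton line (crux-plan, D-0019 two layers) for the crux
`Summit.NavierStokesRegularity.NavierStokesRegularity.Theses.AdaptedFrequency.AdaptedKernelExists`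
of route `AdaptedFrequency`: under the Type-I rate an adapted backward kernel of
`∂ₜ + u·∇ − νΔ` ending at `δ_{x₀}` at the singular time `T` exists for every `x₀` and is
two-sided Gaussian-comparable UNIFORMLY down to `T`.

## The line (idea card `Cruxes/AdaptedKernelExists/Ideas/nash-entropy-last-block.md`)

**Never chain toward the pole.**  The infinitely many dyadic blocks between `t` and `T` are
crossed only by CONSERVATION-TYPE laws of the backward density `G(t,·)` — unit mass and the
**exponential moment law** `∫ e^{⟪α, x−x₀⟫} G(t,x) dx ≤ exp(ν‖α‖²(T−t) + 2C‖α‖√(T−t))`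
(`stub_expMoment`: an ODE in `t` which uses `div b = 0` and pays only the INTEGRABLE Type-I
displacement `∫ₜᵀ C(T−s)^{-1/2} ds = 2C√(T−t)`) — and the pointwise two-sided structure is
manufactured on the SINGLE block `[t, (t+T)/2]` adjacent to the evaluation time, where the
drift is bounded by `A = C√2/√(T−t)` with scale-free budget `A²·(block length)/ν = C²/ν`:
there the tree's drift-robust kernels `k_± = driftKernel (±1) A` (sub/super-solutions for EVERY
measurable drift `‖a‖ ≤ A`: `driftKernel_ineq`, `driftKernelBarrier_ineq`) and the tree's
comparison principles (`IsDriftHeatSolutionOn.paraboloid_comparison`,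
`IsDriftHeatSolutionOn.kernel_lower_bound`) turn Gaussian TIGHTNESS of `G((t+T)/2)` (Chernoff
on the moments) into the Gaussian UPPER bound at `t` (`stub_upperOfMoments`, super-solution
`k₊`), and the bulk MASS of `G((t+T)/2)` (from the upper bound) into the Gaussian LOWER bound
at `t` (`stub_lowerOfUpper`, sub-solution `k₋`) — one convolution each, no chain in space or
time.  Existence is by approximation: a Type-I drift is cut off smoothly in time
(`exists_typeI_cutoff`, PROVED here: `χ(t)·b` with `χ = Real.smoothTransition ((T₁−t)/(T₁−T′))`,
same constant `C`, bounded, `= b` for `t ≤ T′`, vanishing on `[T₁, T)`); bounded smooth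
divergence-free drifts vanishing near `T` have classical adapted kernels with a Gaussian envelope
(`stub_cauchyKernel`); the three a-priori stubs bound these kernels UNIFORMLY in the cut-off; a
compactness step passes to the limit (`stub_kernelLimit`).  The linear theorem so obtained
(constants depending on `(ν, C)` only; `linearTypeIDriftKernel_of`, sorry-free) is transferred to
the crux by choosing `t₀` inside the Type-I window (`AdaptedKernelExists_of`, kernel-checked).

## What gen 3 (the lead's reshape at registration, 2026-08-16) changed relative to gen 2

* SIGNATURES IN TREE VOCABULARY ONLY: the route-local abbreviations `IsTypeIDrift`,
  `GaussianUpper/Lower/Envelope`, `ExpMomentBound`, `E3` of gen 1–2 are UNFOLDED (and the Type-I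
  drift triple CURRIED) in every registered stub, so that each stub helper file under `Theorems/`
  depends on `Literature.*` + Mathlib only and defines nothing (no `Defs` module to review, no
  `tree.vendored-fact`).  `inner ℝ α (x - x₀)` is written without notation.
* NO BOUNDARY CASES IN ANY STUB: three time levels `tb < tₘ < t₀ < T` are threaded through the
  composition.  The drift is smooth / divergence-free / Type-I on `Ico tb T`; the cut-off kernels
  live on `Ico tₘ T` (`stub_cauchyKernel` builds them strictly inside the drift's smoothness slab);
  the three a-priori stubs conclude on the OPEN interval `Ioo t₀ T` of the kernel's slab `Ico t₀ T`
  (their `t₀` is generic; in the composition it is `tₘ`), so every block `[t, t + (T−t)/2]` they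
  work on is interior and the one-sided `timeDerivWithin` is an honest two-sided derivative there;
  `stub_kernelLimit` receives approximants on `Ico tₘ T` with bounds on `Ioo tₘ T` and delivers the
  limit kernel with its bounds on `Ico t₀ T`, `t₀ ∈ Ioo tₘ T` interior.  Mathematically nothing
  changed; every stub lost its endpoint bookkeeping.
* The temporal cut-off is `χ(t) = Real.smoothTransition ((T₁ − t)/(T₁ − T′))` (equal to `1` on
  ALL of `t ≤ T′`, not only on a ball around `t₀`), proved below (`exists_typeI_cutoff`).

Hypotheses each stub genuinely uses are recorded in its docstring (for the standing disprover);
`Disproof.lean` (cycle 1, NO KILL) calibrates the constants: `stub_upperOfMoments` must output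
`C₂ > 4ν` (`gal_not_upper_freeVariance`), `stub_lowerOfUpper`'s `c₁ ≤ (4πν)^{-3/2}e^{-C²/ν}`
(`gal_lower_const_le`), `stub_expMoment` is attained up to sign on the Galilean drift.
-/

noncomputable section

open MeasureTheory Set Filter Topology Metric
open scoped ContDiff

namespace Summit.NavierStokesRegularity.NavierStokesRegularity.Cruxes.AdaptedKernelExists.NashEntropyLastBlock

open Literature.Analysis.FluidPDE

set_option linter.unusedVariables false
set_option linter.dupNamespace false

/-! ### The five registered stubs (tree vocabulary only) -/

/-- **Stub 1 — exponential moment law (the displacement lever; the only a-priori stub that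
touches the pole).**  For a Type-I divergence-free drift `b` on `[t₀, T)` (jointly smooth on
`Ico t₀ T × ℝ³`, `div b(t) = 0`, `‖b(t,x)‖ ≤ C/√(T−t)`) and an adapted backward kernel `G` of
`∂ₜ + b·∇ − νΔ` on `Ico t₀ T` ending at `δ_{x₀}` at time `T` with SOME Gaussian envelope
(`G ≤ K (T−t)^{-3/2} e^{−‖x−x₀‖²/(a(T−t))}` on `Ioo t₀ T`, arbitrary `K`, `a > 0`), all exponential
moments at interior times `t ∈ Ioo t₀ T` are finite and obey
`∫ e^{⟨α,x−x₀⟩} G(t,x) dx ≤ exp(ν‖α‖²(T−t) + 2C‖α‖√(T−t))`.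
Proof sketch: for a smooth radial cut-off `ψ_R` (`= 1` on `B(x₀,R)`, `0` off `B(x₀,2R)`), the
bounded continuous test function `φ_R = ψ_R e^{⟨α,·−x₀⟩}` has `M_R(s) := ∫ φ_R G(s)` differentiable
on `Ioo t₀ T` (differentiation under the integral on a compact `x`-set, `G` jointly `C²`) with
`M_R′ = ∫ G [b·∇φ_R − νΔφ_R]` (adjoint equation; exact integration by parts on a compact set using
`div b = 0`, so only `G` itself appears), whence `M_R′ ≥ −k(s) M_R − err_R(s)`,
`k(s) = C‖α‖/√(T−s) + ν‖α‖²`, with `∫ₜᵀ err_R → 0` as `R → ∞` (the envelope makes the annulus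
terms `O(e^{2‖α‖R − R²/(a(T−t₀))})`, and `‖b‖_∞ ≤ C/√(T−s)` is integrable); integrate
`(M_R e^{−K})′ ≥ −err_R`, `K(s) = ∫ₛᵀ k = 2C‖α‖√(T−s) + ν‖α‖²(T−s)`, from `t` up to `s ↑ T`, where
`M_R(s) → φ_R(x₀) = 1` by the CONCENTRATION clause; let `R → ∞` (monotone convergence;
integrability of `e^{⟨α,·−x₀⟩}G(t)` from the envelope).
Uses: `div b = 0`, the Type-I rate (integrability of `‖b‖_∞` at `T`), concentration, the envelope
(tails only), `C²` + adjoint equation at interior times.  Size M–L.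
Leans on: `IsAdaptedBackwardKernel` (all five clauses), `IsSmoothSpaceTimeOn`,
`VectorCalculus.IsDivFree` (+ `isWeaklyDivFree_holds`), tree cut-off integration-by-parts
patterns (`integral_mul_laplacian_eq_integral_laplacian_mul`-type Green identities,
`integral_fderiv_apply_eq_zero`-type transport identities), Mathlib `ContDiffBump`,
`hasDerivAt_integral_of_dominated_loc_of_deriv_le`, `intervalIntegral` FTC /
`image_le_of_deriv_right_lt_deriv_boundary` (ODE comparison), `real_inner_le_norm`,
`MeasureTheory.integral_mono`, `MeasureTheory.integral_tendsto_of_tendsto_of_monotone`. -/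
theorem stub_expMoment :
    ∀ (ν C t₀ T : ℝ) (b : ℝ → EuclideanSpace ℝ (Fin 3) → EuclideanSpace ℝ (Fin 3))
      (x₀ : EuclideanSpace ℝ (Fin 3)) (G : ℝ → EuclideanSpace ℝ (Fin 3) → ℝ),
      0 < ν → 0 ≤ C → t₀ < T →
      IsSmoothSpaceTimeOn (Ico t₀ T) b →
      (∀ t ∈ Ico t₀ T, VectorCalculus.IsDivFree (b t)) →
      (∀ t ∈ Ico t₀ T, ∀ x, ‖b t x‖ ≤ C / Real.sqrt (T - t)) →
      IsAdaptedBackwardKernel ν b (Ico t₀ T) T x₀ G →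
      (∃ K a : ℝ, 0 < a ∧ ∀ t ∈ Ioo t₀ T, ∀ x,
        G t x ≤ K * (T - t) ^ (-(3:ℝ) / 2) * Real.exp (-(‖x - x₀‖ ^ 2) / (a * (T - t)))) →
      ∀ (α : EuclideanSpace ℝ (Fin 3)), ∀ t ∈ Ioo t₀ T,
        Integrable (fun x => Real.exp (inner ℝ α (x - x₀)) * G t x) ∧
        ∫ x, Real.exp (inner ℝ α (x - x₀)) * G t x ≤
          Real.exp (ν * ‖α‖ ^ 2 * (T - t) + 2 * C * ‖α‖ * Real.sqrt (T - t)) := by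
  sorry

/-- **Stub 2 — Gaussian upper bound on the last block (super-solution `k₊` + tightness).**
There are `C₁, C₂ > 0` depending only on `(ν, C)` such that every adapted kernel on `Ico t₀ T`
(pole `(T, x₀)`, with SOME Gaussian envelope on `Ioo t₀ T`) of a Type-I divergence-free drift with
constant `C`, obeying the exponential moment bound of Stub 1 on `Ioo t₀ T`, satisfies
`G(t,x) ≤ C₁ (T−t)^{-3/2} exp(−‖x−x₀‖²/(C₂(T−t)))` for all INTERIOR `t ∈ Ioo t₀ T`.
Proof sketch (`h = T − t`, `t′ = t + h/2 ∈ Ioo t₀ T`): (i) Chernoff on the moments at `t′`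
(`T − t′ = h/2`; six coordinate half-spaces, `‖α‖ = r/(νh)`): the mass of `G(t′)` outside
`B(x₀, r)` is `≤ 6 exp(−r²/(6νh) + C r/(ν√h))`; (ii) BRIDGE: `v(σ, x) := G(t′ − σ/ν, x)`,
`σ ∈ [0, νh/2]`, lies in the tree class `IsDriftHeatSolutionOn a v A (Icc 0 (νh/2)) univ` with
`a(σ,x) = −b(t′−σ/ν, x)/ν` (extended measurably by `0`), `A = C√2/(ν√h)` — so `A²σ ≤ C²/ν`,
`A√σ ≤ C/√ν` — (`contDiffOn`/joint continuity of `∇v, Δv` from the `C²` clause at interior times,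
`integral_eq` by FTC from the pointwise adjoint equation); (iii) comparison:
`paraboloid_comparison` (straight cylinder `P ≡ ρ²`) applied to `−v` (`IsDriftHeatSolutionOn.neg`)
with the barrier `−(driftKernelBarrier 1 A (G(t′)ψ) (σ + σ₀) + δ)` (`ψ` a cut-off equal to `1` on
`B̄(x₀,ρ)`; a classical SUPER-solution for every drift `‖a‖ ≤ A` by `driftKernelBarrier_ineq`,
`ε = 1`; bottom: `k₊ ≥ heatKernel` (`driftKernel_eq_heatKernel_mul`, `driftKernel_tilt_nonneg`)
and the one-sided approximate identity `e^{σ₀Δ}g ≥ g − δ` on the compact ball, cf.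
`exists_heatExtension_le_add`; side: `v ≤ δ` on `‖x−x₀‖ = ρ` for `ρ` large by the ENVELOPE)
gives, after `σ₀, δ → 0`, `ρ → ∞`: `G(t, x) ≤ ∫ k₊(νh/2, x − z) G(t′, z) dz`;
(iv) `k₊(σ,y) ≤ (4πσ)^{-3/2} e^{−‖y‖²/(8σ)} e^{9A√σ + 4A²σ}` (`driftKernel_le`,
`A‖y‖ ≤ ‖y‖²/(8σ) + 2A²σ`) with `σ = νh/2`, and the split `‖z−x₀‖ ≶ ‖x−x₀‖/2` together with (i)
give the claim with `C₂ = 48ν`, `C₁ = 7(2πν)^{-3/2} e^{c(C²/ν + C/√ν)}`; on the diagonal this is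
the drift-independent cap `G ≤ c(ν,C)(T−t)^{-3/2}` with NO Nash inequality (Carlen–Loss 1995 Thm 3
in displacement form, by a barrier proof instead of Davies–Nash).  The disprover's Galilean drift
forces `C₂ > 4ν` (`Disproof.gal_not_upper_freeVariance`).
Uses: the Type-I rate only on the last block (`‖b‖ ≤ C√2/√h` there), positivity/`C²`/equation at
interior times, the envelope (side values only); NOT `div b = 0`.  Size L.
Leans on: `driftKernel`, `driftKernel_le`, `driftKernel_eq_heatKernel_mul`,
`driftKernel_tilt_nonneg`, `driftKernel_le_kSupMax`, `driftKernel_le_kSupTail`,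
`driftKernelBarrier`, `driftKernelBarrier_ineq`, `contDiff_driftKernelBarrier`,
`hasDerivAt_driftKernelBarrier_sigma`, `IsDriftHeatSolutionOn.paraboloid_comparison`,
`IsDriftHeatSolutionOn.neg/.mono`, `exists_heatExtension_le_add` (pattern), Mathlib
`ContDiffBump`, Gaussian integrals (`integral_gaussian`-family, `GaussianFourier`). -/
theorem stub_upperOfMoments :
    ∀ (ν C : ℝ), 0 < ν → 0 ≤ C → ∃ C₁ C₂ : ℝ, 0 < C₁ ∧ 0 < C₂ ∧
      ∀ (t₀ T : ℝ) (b : ℝ → EuclideanSpace ℝ (Fin 3) → EuclideanSpace ℝ (Fin 3))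
        (x₀ : EuclideanSpace ℝ (Fin 3)) (G : ℝ → EuclideanSpace ℝ (Fin 3) → ℝ),
        t₀ < T →
        IsSmoothSpaceTimeOn (Ico t₀ T) b →
        (∀ t ∈ Ico t₀ T, VectorCalculus.IsDivFree (b t)) →
        (∀ t ∈ Ico t₀ T, ∀ x, ‖b t x‖ ≤ C / Real.sqrt (T - t)) →
        IsAdaptedBackwardKernel ν b (Ico t₀ T) T x₀ G →
        (∃ K a : ℝ, 0 < a ∧ ∀ t ∈ Ioo t₀ T, ∀ x,
          G t x ≤ K * (T - t) ^ (-(3:ℝ) / 2) * Real.exp (-(‖x - x₀‖ ^ 2) / (a * (T - t)))) →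
        (∀ (α : EuclideanSpace ℝ (Fin 3)), ∀ t ∈ Ioo t₀ T,
          Integrable (fun x => Real.exp (inner ℝ α (x - x₀)) * G t x) ∧
          ∫ x, Real.exp (inner ℝ α (x - x₀)) * G t x ≤
            Real.exp (ν * ‖α‖ ^ 2 * (T - t) + 2 * C * ‖α‖ * Real.sqrt (T - t))) →
        ∀ t ∈ Ioo t₀ T, ∀ x,
          G t x ≤ C₁ * (T - t) ^ (-(3:ℝ) / 2) * Real.exp (-(‖x - x₀‖ ^ 2) / (C₂ * (T - t))) := by
  sorry

/-- **Stub 3 — Gaussian lower bound on the last block (sub-solution `k₋` + bulk mass).**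
There are `c₁, c₂ > 0` depending only on `(ν, C, C₁, C₂)` such that every adapted kernel on
`Ico t₀ T` (pole `(T, x₀)`) of a Type-I divergence-free drift with constant `C`, obeying the
Gaussian upper bound `(C₁, C₂)` on `Ioo t₀ T`, satisfies
`c₁ (T−t)^{-3/2} exp(−‖x−x₀‖²/(c₂(T−t))) ≤ G(t,x)` for all INTERIOR `t ∈ Ioo t₀ T`.
Proof sketch (`h = T − t`, `t′ = t + h/2`): unit mass and the upper bound give `R = R(C₁, C₂)`
with `∫_{B(x₀, R√h)} G(t′) ≥ 1/2` (the Gaussian `C₁(h/2)^{-3/2}e^{−‖z−x₀‖²/(C₂h/2)}` has mass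
`≤ 1/2` outside `B(x₀,R√h)` for `R` large, scale-invariantly: bound the indicator of the exterior
by `e^{−R²/C₂} e^{−‖z−x₀‖²/(C₂ h)}` and use `∫ e^{−‖z‖²/c} = (πc)^{3/2}`); with `v`, `a`, `A` as in
the BRIDGE of Stub 2 (`v ≥ 0` is the positivity clause; all times in `[t, t′] ⊂ Ioo t₀ T` are
interior) apply the tree's `IsDriftHeatSolutionOn.kernel_lower_bound` on `U = univ`, centre
`c = x₀`, weight `h := G(t′)·φ` (`φ` a continuous cut-off of `B̄(x₀, R√h)`,
`tsupport ⊆ B̄(x₀, 2R√h) =: B̄(x₀, r_s)`), `r_e := ‖x − x₀‖`, and a ball radius `ρ → ∞` (room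
condition `6·νh/2 < (ρ − r_s)²`; the correction `gaussTail 3 (ρ − r_s) (νh/2) → 0`):
`G(t,x) = v(νh/2, x) ≥ ½ · kSubLow 3 A (‖x−x₀‖ + 2R√h) (νh/2)`, and
`kSubLow 3 A D σ = (4πσ)^{-3/2} e^{−D²/(4σ)} e^{−dkTilt 3 A D σ}`, `dkTilt ≤ A D + 9C/√ν + 2C²/ν`,
`A D ≤ C²/ν + ‖x−x₀‖²/(2νh) + 2√2 RC/ν`: the claim with `c₂ = 2ν/3` and
`c₁ = c₁(ν, C, C₁, C₂) > 0` (the disprover's Galilean drift forces `c₁ ≤ (4πν)^{-3/2}e^{-C²/ν}`,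
`Disproof.gal_lower_const_le`; Maekawa 2008, ARMA 189, Thm 1.1 is the printed lower bound).
Uses: the Type-I rate on the last block, positivity, `C²`, the equation at interior times, unit
mass; NOT `div b = 0`.  Size M (the comparison is in the tree; the work is the BRIDGE — shared
with Stub 2 — and the constants).
Leans on: `IsDriftHeatSolutionOn.kernel_lower_bound`, `kSubLow`, `kSubLow_pos`,
`kSubLow_le_driftKernel`, `gaussTail`, `dkTilt`, `continuousOn_kSubLow`,
`tendsto_gaussTail_div_kSubLow_nhdsGT_zero` (pattern), `IsAdaptedBackwardKernel.pos/.contDiffOn/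
.adjoint_eq/.integral_eq_one`, Mathlib `ContDiffBump`, `MeasureTheory.setIntegral_le_integral`,
`integral_rexp_neg_mul_sq_norm` (Gaussian integral on an inner product space). -/
theorem stub_lowerOfUpper :
    ∀ (ν C C₁ C₂ : ℝ), 0 < ν → 0 ≤ C → 0 < C₁ → 0 < C₂ → ∃ c₁ c₂ : ℝ, 0 < c₁ ∧ 0 < c₂ ∧
      ∀ (t₀ T : ℝ) (b : ℝ → EuclideanSpace ℝ (Fin 3) → EuclideanSpace ℝ (Fin 3))
        (x₀ : EuclideanSpace ℝ (Fin 3)) (G : ℝ → EuclideanSpace ℝ (Fin 3) → ℝ),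
        t₀ < T →
        IsSmoothSpaceTimeOn (Ico t₀ T) b →
        (∀ t ∈ Ico t₀ T, VectorCalculus.IsDivFree (b t)) →
        (∀ t ∈ Ico t₀ T, ∀ x, ‖b t x‖ ≤ C / Real.sqrt (T - t)) →
        IsAdaptedBackwardKernel ν b (Ico t₀ T) T x₀ G →
        (∀ t ∈ Ioo t₀ T, ∀ x,
          G t x ≤ C₁ * (T - t) ^ (-(3:ℝ) / 2) * Real.exp (-(‖x - x₀‖ ^ 2) / (C₂ * (T - t)))) →
        ∀ t ∈ Ioo t₀ T, ∀ x,
          c₁ * (T - t) ^ (-(3:ℝ) / 2) * Real.exp (-(‖x - x₀‖ ^ 2) / (c₂ * (T - t))) ≤ G t x := by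
  sorry

/-- **Stub 4 — adapted kernels with a REGULAR pole exist (classical linear theory; the `T′ < T`
case of the crux named by the grounder).**  For `ν > 0`, times `tb < tₘ < T`, and a jointly
smooth, bounded, divergence-free drift `b` on `[tb, T) × ℝ³` that VANISHES on `[T₁, T)` for some
`T₁ ∈ (tₘ, T)`, there is an adapted backward kernel `G` of `∂ₜ + b·∇ − νΔ` on the INTERIOR slab
`Ico tₘ T` with pole `(T, x₀)`, and it has a Gaussian envelope on `Ioo tₘ T` (arbitrary constant
`K`, arbitrary rate `a > 0`).  (The drift is smooth on the larger slab `Ico tb T`, so nothing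
one-sided happens at `tₘ`.)
Proof sketch (no fundamental-solution theory, no gluing): in reversed time `τ = T − t` and with
`σ = ντ`, look for `G̃(σ) = G(T − σ/ν)` as `Γ̃(σ) + w(σ)`, `Γ̃(σ) =` heat kernel of age `σ` centred
at `x₀` (`backwardHeatKernel ν T x₀ (T − σ/ν)`), where `w` solves the FORCED mild equation
`w(σ) = Σⱼ heatGradDuhamel 0 (ãⱼ (Γ̃ + w)) eⱼ σ` with `ã(σ) = b(T − σ/ν)/ν`
(`div ã = 0` ⇒ `ã·∇G̃ = div(ã G̃)`, so the derivative sits on the heat kernel and ONLY sup norms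
enter); `ã = 0` for `σ < ν(T − T₁)`, so `w = 0` there and the datum is never singular.  Picard in
`L^∞` on steps of length `ℓ` with `c‖ã‖_∞√ℓ < 1` (finitely many restarts: the linear problem
cannot blow up) gives a bounded measurable `w`; LOCAL REGULARITY (the Hölder bootstrap of
`ForcedHeatDuhamelHolder` / `DriftMildBootstrap`: `exists_heatGradDuhamel_holder_step`, the drift
smooth with bounded derivatives on compacts, far field carried by kernel decay) makes `G̃` smooth in
`x` with `σ`-continuous derivatives, time regularity follows from the mild formula
(`ForcedHeatDuhamelTime`) and then from the equation, so `G` is `C²` (indeed `C^∞`) on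
`Ioo tb T × ℝ³ ⊇ Ico tₘ T × ℝ³` and solves the adjoint equation pointwise; positivity by the weak
minimum principle on large balls (`paraboloid_comparison`; `G → 0` at spatial infinity) and strict
positivity by `kernel_lower_bound`; unit mass `d/dt ∫G = 0` by `div b = 0` + envelope;
concentration at `x₀` because `G =` the backward heat kernel on `[T₁, T)`
(`tendsto_integral_mul_backwardHeatKernel`); envelope by ONE comparison with
`driftKernelBarrier 1 (B/ν) Γ(T₁)` over the finite slab `[tₘ, T₁]` (`driftKernel_le`: Gaussian
variances add, any rate `a > 4ν·(1 + slack)` with a huge but finite `K`).  Alternative inside the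
stub: Dirichlet problems on balls `B_R ↑ ℝ³` if a Galerkin/energy route is preferred, or a
vendored Cauchy-problem fact à la Friedman 1964 Ch. 1 Thm 12 / LSU 1968 Ch. IV Thm 5.1 stated
inline with `[cite] [topic Analysis/FluidPDE]` (it then makes the crux conditional until proved).
Uses: `div b = 0` (mass), smoothness, boundedness, vanishing near `T`; NOT any rate.  Size XL.
Leans on: `backwardHeatKernel` + `isAdaptedBackwardKernel_backwardHeatKernel(_Ico)`,
`backwardHeatKernel_eq`, `tendsto_integral_mul_backwardHeatKernel`, `heatGradDuhamel`,
`heatDuhamel`, `exists_heatGradDuhamel_holder_step`, `IsHolderField.heatExtension`,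
`UnboundedOperators.heatExtension` calculus, `ForcedHeatDuhamelTime` lemmas,
`driftKernelBarrier_ineq` (ε = 1), `IsDriftHeatSolutionOn.paraboloid_comparison`,
`IsDriftHeatSolutionOn.kernel_lower_bound`, `VectorCalculus.IsDivFree.isWeaklyDivFree_holds`. -/
theorem stub_cauchyKernel :
    ∀ (ν tb tₘ T : ℝ) (b : ℝ → EuclideanSpace ℝ (Fin 3) → EuclideanSpace ℝ (Fin 3))
      (x₀ : EuclideanSpace ℝ (Fin 3)), 0 < ν → tb < tₘ → tₘ < T →
      IsSmoothSpaceTimeOn (Ico tb T) b →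
      (∀ t ∈ Ico tb T, VectorCalculus.IsDivFree (b t)) →
      (∃ B : ℝ, ∀ t ∈ Ico tb T, ∀ x, ‖b t x‖ ≤ B) →
      (∃ T₁ ∈ Ioo tₘ T, ∀ t ∈ Ico T₁ T, ∀ x, b t x = 0) →
        ∃ G : ℝ → EuclideanSpace ℝ (Fin 3) → ℝ,
          IsAdaptedBackwardKernel ν b (Ico tₘ T) T x₀ G ∧
          ∃ K a : ℝ, 0 < a ∧ ∀ t ∈ Ioo tₘ T, ∀ x,
            G t x ≤ K * (T - t) ^ (-(3:ℝ) / 2) * Real.exp (-(‖x - x₀‖ ^ 2) / (a * (T - t))) := by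
  sorry

/-- **Stub 5 — passage to the limit (compactness of uniformly comparable kernels).**  Let `b`
be jointly smooth on `[tₘ, T) × ℝ³` (nothing else is assumed of `b`) and `tₘ < t₀ < T`.  If for
every `T′ ∈ (t₀, T)` SOME drift `b′` that coincides with `b` on `[tₘ, T′]` carries an adapted
kernel `G′` on `Ico tₘ T` with pole `(T, x₀)` obeying two-sided Gaussian bounds with FIXED constants
`(c₁, c₂, C₁, C₂)` at the interior times `Ioo tₘ T`, then `b` itself carries an adapted kernel on
the INTERIOR slab `Ico t₀ T` with pole `(T, x₀)` and the same bounds on all of `Ico t₀ T`.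
Proof sketch: pick `T′ₙ ↑ T`; on every compact `[t₀ − ε, T*] × B̄_R`, `T* < T`, `ε < t₀ − tₘ`, the
kernels `Gₙ` (`n` large) solve the SAME equation `∂ₜG + b·∇G + νΔG = 0` with the smooth drift `b`
and are uniformly bounded above and below (the bounds at `(T, x₀)` are uniform on the compact).
LOCAL REGULARITY for the drift–heat equation with smooth drift (interior estimates looking only
into the parabolic past `τ > t`; first derivatives also from the tree's Ishii–Lions bound
`IsDriftHeatSolutionOn.abs_sub_le_lipConst`, which depends on `sup G` and the drift bound only)
gives bounds on `∇ₓᵏGₙ` (`k ≤ 4`) and, through the equation, on `∂ₜGₙ, ∂ₜ∇ₓGₙ, ∂ₜ²Gₙ`, uniformly in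
`n` on each compact; Arzelà–Ascoli and a diagonal argument give `Gₙ → G` in `C²_loc` along a
subsequence (equivalently: pass to the limit in the divergence-form MILD identity
`Gₙ(t) = e^{ν(T*−t)Δ}Gₙ(T*) + ∫ₜ^{T*} ∇e^{ν(s−t)Δ}·(bGₙ)(s) ds`, which needs only locally uniform
convergence, and re-derive regularity of the limit from it).  The limit `G` is `C²` on a
neighbourhood of `Ico t₀ T × ℝ³`, solves the adjoint equation, is positive (uniform lower bound),
has unit mass (dominated convergence under the uniform Gaussian upper bound) and CONCENTRATES at
`x₀` from the uniform UPPER bound + unit mass alone: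
`|∫φG(t) − φ(x₀)| ≤ osc_{B(x₀,η)} φ + 2‖φ‖_∞ C₁ ∫_{‖z‖>η} (T−t)^{-3/2} e^{−‖z‖²/(C₂(T−t))} dz → 0`;
the bounds pass to the pointwise limit (at `t₀` itself they hold because `t₀` is interior to
`Ioo tₘ T`).  Uses: only the uniform bounds it is handed and the smoothness of `b`; no NS
structure, no rate, no `div b = 0`.  Size XL (interior `C^{2,α}` / mild-bootstrap compactness for
the drift–heat class is not in the tree; nearest pieces: `DriftHeatInteriorLipschitz`,
`DriftMildBootstrap`, `ForcedHeatDuhamelHolder/Time`, `SmoothParabolicHolder`).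
Leans on: `IsDriftHeatSolutionOn.abs_sub_le_lipConst`, `lipConst`,
`IsDriftHeatSolutionOn.continuousOn_uncurry`, `heatGradDuhamel` + its Hölder steps, Mathlib
`BoundedContinuousFunction.arzela_ascoli` / `ArzelaAscoli`,
`MeasureTheory.tendsto_integral_of_dominated_convergence`. -/
theorem stub_kernelLimit :
    ∀ (ν c₁ c₂ C₁ C₂ tₘ t₀ T : ℝ) (b : ℝ → EuclideanSpace ℝ (Fin 3) → EuclideanSpace ℝ (Fin 3))
      (x₀ : EuclideanSpace ℝ (Fin 3)),
      0 < ν → 0 < c₁ → 0 < c₂ → 0 < C₁ → 0 < C₂ → tₘ < t₀ → t₀ < T →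
      IsSmoothSpaceTimeOn (Ico tₘ T) b →
      (∀ T' : ℝ, t₀ < T' → T' < T →
        ∃ (b' : ℝ → EuclideanSpace ℝ (Fin 3) → EuclideanSpace ℝ (Fin 3))
          (G' : ℝ → EuclideanSpace ℝ (Fin 3) → ℝ),
          (∀ t ∈ Icc tₘ T', b' t = b t) ∧ IsAdaptedBackwardKernel ν b' (Ico tₘ T) T x₀ G' ∧
          (∀ t ∈ Ioo tₘ T, ∀ x,
            c₁ * (T - t) ^ (-(3:ℝ) / 2) * Real.exp (-(‖x - x₀‖ ^ 2) / (c₂ * (T - t))) ≤ G' t x) ∧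
          (∀ t ∈ Ioo tₘ T, ∀ x,
            G' t x ≤ C₁ * (T - t) ^ (-(3:ℝ) / 2) * Real.exp (-(‖x - x₀‖ ^ 2) / (C₂ * (T - t))))) →
      ∃ G : ℝ → EuclideanSpace ℝ (Fin 3) → ℝ,
        IsAdaptedBackwardKernel ν b (Ico t₀ T) T x₀ G ∧
        (∀ t ∈ Ico t₀ T, ∀ x,
          c₁ * (T - t) ^ (-(3:ℝ) / 2) * Real.exp (-(‖x - x₀‖ ^ 2) / (c₂ * (T - t))) ≤ G t x) ∧
        (∀ t ∈ Ico t₀ T, ∀ x,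
          G t x ≤ C₁ * (T - t) ^ (-(3:ℝ) / 2) * Real.exp (-(‖x - x₀‖ ^ 2) / (C₂ * (T - t)))) := by
  sorry

/-! ### Smooth temporal cut-off of a Type-I drift (sorry-free; used by the composition) -/

/-- `div (c • v) = c · div v` at a point of differentiability (local copy of the tree's
`divergence_const_smul_apply`, `PressurePoisson.lean`, to keep the imports light). -/
theorem divergence_const_smul_apply' {v : EuclideanSpace ℝ (Fin 3) → EuclideanSpace ℝ (Fin 3)}
    {x : EuclideanSpace ℝ (Fin 3)} (hv : DifferentiableAt ℝ v x) (c : ℝ) :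
    VectorCalculus.divergence (fun y => c • v y) x = c * VectorCalculus.divergence v x := by
  simp only [VectorCalculus.divergence, fderiv_fun_const_smul hv c,
    ContinuousLinearMap.toLinearMap_smul, map_smul, smul_eq_mul]

/-- **Smooth temporal cut-off.**  A jointly smooth, divergence-free drift `b` on `Ico tb T` with
the Type-I bound `‖b(t,x)‖ ≤ C/√(T−t)` and times `tb < T′ < T` admit a drift `b′ = χ(t) • b`,
`χ(t) = Real.smoothTransition ((T₁ − t)/(T₁ − T′))`, `T₁ = (T′ + T)/2` (`χ = 1` for `t ≤ T′`,
`χ = 0` for `t ≥ T₁`, `0 ≤ χ ≤ 1`), which is again smooth, divergence free and Type-I with the SAME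
constant on `Ico tb T`, coincides with `b` on `t ≤ T′`, is bounded (by `C/√(T − T₁)`), and
vanishes on `[T₁, T)`, `T₁ ∈ Ioo T′ T`. -/
theorem exists_typeI_cutoff {C tb T T' : ℝ}
    {b : ℝ → EuclideanSpace ℝ (Fin 3) → EuclideanSpace ℝ (Fin 3)} (hC : 0 ≤ C)
    (hsm : IsSmoothSpaceTimeOn (Ico tb T) b)
    (hdiv : ∀ t ∈ Ico tb T, VectorCalculus.IsDivFree (b t))
    (hrate : ∀ t ∈ Ico tb T, ∀ x, ‖b t x‖ ≤ C / Real.sqrt (T - t))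
    (htb : tb < T') (hT' : T' < T) :
    ∃ b' : ℝ → EuclideanSpace ℝ (Fin 3) → EuclideanSpace ℝ (Fin 3),
      IsSmoothSpaceTimeOn (Ico tb T) b' ∧
      (∀ t ∈ Ico tb T, VectorCalculus.IsDivFree (b' t)) ∧
      (∀ t ∈ Ico tb T, ∀ x, ‖b' t x‖ ≤ C / Real.sqrt (T - t)) ∧
      (∀ t ∈ Ico tb T, t ≤ T' → b' t = b t) ∧
      (∃ B : ℝ, ∀ t ∈ Ico tb T, ∀ x, ‖b' t x‖ ≤ B) ∧
      (∃ T₁ ∈ Ioo T' T, ∀ t ∈ Ico T₁ T, ∀ x, b' t x = 0) := by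
  set T₁ : ℝ := (T' + T) / 2 with hT₁_def
  have hT₁' : T' < T₁ := by rw [hT₁_def]; linarith
  have hT₁T : T₁ < T := by rw [hT₁_def]; linarith
  have hgap : 0 < T₁ - T' := sub_pos.2 hT₁'
  -- the cut-off function
  set χ : ℝ → ℝ := fun t => Real.smoothTransition ((T₁ - t) / (T₁ - T')) with hχ_def
  have hχ0 : ∀ t, 0 ≤ χ t := fun t => Real.smoothTransition.nonneg _
  have hχ1 : ∀ t, χ t ≤ 1 := fun t => Real.smoothTransition.le_one _
  have hχone : ∀ t, t ≤ T' → χ t = 1 := by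
    intro t ht
    apply Real.smoothTransition.one_of_one_le
    rw [le_div_iff₀ hgap]
    linarith
  have hχzero : ∀ t, T₁ ≤ t → χ t = 0 := by
    intro t ht
    apply Real.smoothTransition.zero_of_nonpos
    exact div_nonpos_of_nonpos_of_nonneg (by linarith) hgap.le
  have hχs : ContDiff ℝ ∞ χ := by
    have h1 : ContDiff ℝ ∞ (fun t : ℝ => (T₁ - t) / (T₁ - T')) := by
      have : (fun t : ℝ => (T₁ - t) / (T₁ - T')) = fun t => (T₁ - T')⁻¹ * (T₁ - t) := by
        funext t; rw [div_eq_inv_mul]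
      rw [this]
      fun_prop
    exact Real.smoothTransition.contDiff.comp h1
  -- pointwise norm control of the cut-off drift
  have hnorm : ∀ t x, ‖χ t • b t x‖ ≤ ‖b t x‖ := by
    intro t x
    rw [norm_smul, Real.norm_eq_abs, abs_of_nonneg (hχ0 t)]
    calc χ t * ‖b t x‖ ≤ 1 * ‖b t x‖ := mul_le_mul_of_nonneg_right (hχ1 t) (norm_nonneg _)
      _ = ‖b t x‖ := one_mul _
  refine ⟨fun t x => χ t • b t x, ?_, ?_, ?_, ?_, ?_, ?_⟩
  · -- joint smoothness of `(t, x) ↦ χ t • b t x` on the slab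
    have hχs' : ContDiffOn ℝ ∞ (fun p : ℝ × EuclideanSpace ℝ (Fin 3) => χ p.1)
        (Ico tb T ×ˢ univ) := (hχs.comp contDiff_fst).contDiffOn
    exact hχs'.smul hsm
  · -- divergence free slices
    intro t ht x
    have hd : DifferentiableAt ℝ (b t) x :=
      ((hsm.contDiff_slice ht).differentiable (by simp)) x
    rw [divergence_const_smul_apply' hd, hdiv t ht x, mul_zero]
  · -- the Type-I rate with the same constant
    intro t ht x
    exact (hnorm t x).trans (hrate t ht x)
  · -- agreement with `b` for `t ≤ T′`
    intro t _ htT'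
    funext x
    show χ t • b t x = b t x
    rw [hχone t htT', one_smul]
  · -- a uniform bound
    refine ⟨C / Real.sqrt (T - T₁), fun t ht x => ?_⟩
    by_cases hle : T₁ ≤ t
    · show ‖χ t • b t x‖ ≤ C / Real.sqrt (T - T₁)
      rw [hχzero t hle, zero_smul, norm_zero]
      exact div_nonneg hC (Real.sqrt_nonneg _)
    · push Not at hle
      have h1 : ‖b t x‖ ≤ C / Real.sqrt (T - t) := hrate t ht x
      have h2 : C / Real.sqrt (T - t) ≤ C / Real.sqrt (T - T₁) :=
        div_le_div_of_nonneg_left hC (Real.sqrt_pos.2 (by linarith))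
          (Real.sqrt_le_sqrt (by linarith))
      exact ((hnorm t x).trans h1).trans h2
  · -- vanishing near the pole
    refine ⟨T₁, ⟨hT₁', hT₁T⟩, fun t ht x => ?_⟩
    show χ t • b t x = 0
    rw [hχzero t ht.1, zero_smul]

/-! ### Composition (kernel-checked, no `sorry` below this line) -/

/-- **The linear theorem `C⁺` from the five stubs**: for every `ν > 0`, `C ≥ 0` there are
constants `c₁, c₂, C₁, C₂ > 0` such that every jointly smooth, divergence-free, Type-I drift on a
slab `Ico tb T` admits, at every `x₀` and on every interior slab `Ico t₀ T` (`tb < t₀ < T`), an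
adapted backward kernel with pole `(T, x₀)` obeying the two-sided Gaussian bounds
`(c₁, c₂, C₁, C₂)` on `Ico t₀ T` — the transfer target `LinearTypeIDriftKernel` of the idea cards.
Logic (three time levels `tb < tₘ := (tb+t₀)/2 < t₀`): constants from stubs 2–3; for each
`T′ ∈ (t₀, T)` cut the drift off beyond `T′` (`exists_typeI_cutoff`, on `Ico tb T`), take the
kernel of stub 4 on `Ico tₘ T`, bound it on `Ioo tₘ T` by stubs 1 → 2 → 3 (it is a kernel of a
Type-I drift with the SAME `C`), and pass to the limit on `Ico t₀ T` with stub 5. -/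
theorem linearTypeIDriftKernel_of
    (h1 : ∀ (ν C t₀ T : ℝ) (b : ℝ → EuclideanSpace ℝ (Fin 3) → EuclideanSpace ℝ (Fin 3))
      (x₀ : EuclideanSpace ℝ (Fin 3)) (G : ℝ → EuclideanSpace ℝ (Fin 3) → ℝ),
      0 < ν → 0 ≤ C → t₀ < T →
      IsSmoothSpaceTimeOn (Ico t₀ T) b →
      (∀ t ∈ Ico t₀ T, VectorCalculus.IsDivFree (b t)) →
      (∀ t ∈ Ico t₀ T, ∀ x, ‖b t x‖ ≤ C / Real.sqrt (T - t)) →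
      IsAdaptedBackwardKernel ν b (Ico t₀ T) T x₀ G →
      (∃ K a : ℝ, 0 < a ∧ ∀ t ∈ Ioo t₀ T, ∀ x,
        G t x ≤ K * (T - t) ^ (-(3:ℝ) / 2) * Real.exp (-(‖x - x₀‖ ^ 2) / (a * (T - t)))) →
      ∀ (α : EuclideanSpace ℝ (Fin 3)), ∀ t ∈ Ioo t₀ T,
        Integrable (fun x => Real.exp (inner ℝ α (x - x₀)) * G t x) ∧
        ∫ x, Real.exp (inner ℝ α (x - x₀)) * G t x ≤
          Real.exp (ν * ‖α‖ ^ 2 * (T - t) + 2 * C * ‖α‖ * Real.sqrt (T - t)))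
    (h2 : ∀ (ν C : ℝ), 0 < ν → 0 ≤ C → ∃ C₁ C₂ : ℝ, 0 < C₁ ∧ 0 < C₂ ∧
      ∀ (t₀ T : ℝ) (b : ℝ → EuclideanSpace ℝ (Fin 3) → EuclideanSpace ℝ (Fin 3))
        (x₀ : EuclideanSpace ℝ (Fin 3)) (G : ℝ → EuclideanSpace ℝ (Fin 3) → ℝ),
        t₀ < T →
        IsSmoothSpaceTimeOn (Ico t₀ T) b →
        (∀ t ∈ Ico t₀ T, VectorCalculus.IsDivFree (b t)) →
        (∀ t ∈ Ico t₀ T, ∀ x, ‖b t x‖ ≤ C / Real.sqrt (T - t)) →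
        IsAdaptedBackwardKernel ν b (Ico t₀ T) T x₀ G →
        (∃ K a : ℝ, 0 < a ∧ ∀ t ∈ Ioo t₀ T, ∀ x,
          G t x ≤ K * (T - t) ^ (-(3:ℝ) / 2) * Real.exp (-(‖x - x₀‖ ^ 2) / (a * (T - t)))) →
        (∀ (α : EuclideanSpace ℝ (Fin 3)), ∀ t ∈ Ioo t₀ T,
          Integrable (fun x => Real.exp (inner ℝ α (x - x₀)) * G t x) ∧
          ∫ x, Real.exp (inner ℝ α (x - x₀)) * G t x ≤
            Real.exp (ν * ‖α‖ ^ 2 * (T - t) + 2 * C * ‖α‖ * Real.sqrt (T - t))) →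
        ∀ t ∈ Ioo t₀ T, ∀ x,
          G t x ≤ C₁ * (T - t) ^ (-(3:ℝ) / 2) * Real.exp (-(‖x - x₀‖ ^ 2) / (C₂ * (T - t))))
    (h3 : ∀ (ν C C₁ C₂ : ℝ), 0 < ν → 0 ≤ C → 0 < C₁ → 0 < C₂ → ∃ c₁ c₂ : ℝ, 0 < c₁ ∧ 0 < c₂ ∧
      ∀ (t₀ T : ℝ) (b : ℝ → EuclideanSpace ℝ (Fin 3) → EuclideanSpace ℝ (Fin 3))
        (x₀ : EuclideanSpace ℝ (Fin 3)) (G : ℝ → EuclideanSpace ℝ (Fin 3) → ℝ),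
        t₀ < T →
        IsSmoothSpaceTimeOn (Ico t₀ T) b →
        (∀ t ∈ Ico t₀ T, VectorCalculus.IsDivFree (b t)) →
        (∀ t ∈ Ico t₀ T, ∀ x, ‖b t x‖ ≤ C / Real.sqrt (T - t)) →
        IsAdaptedBackwardKernel ν b (Ico t₀ T) T x₀ G →
        (∀ t ∈ Ioo t₀ T, ∀ x,
          G t x ≤ C₁ * (T - t) ^ (-(3:ℝ) / 2) * Real.exp (-(‖x - x₀‖ ^ 2) / (C₂ * (T - t)))) →
        ∀ t ∈ Ioo t₀ T, ∀ x,
          c₁ * (T - t) ^ (-(3:ℝ) / 2) * Real.exp (-(‖x - x₀‖ ^ 2) / (c₂ * (T - t))) ≤ G t x)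
    (h4 : ∀ (ν tb tₘ T : ℝ) (b : ℝ → EuclideanSpace ℝ (Fin 3) → EuclideanSpace ℝ (Fin 3))
      (x₀ : EuclideanSpace ℝ (Fin 3)), 0 < ν → tb < tₘ → tₘ < T →
      IsSmoothSpaceTimeOn (Ico tb T) b →
      (∀ t ∈ Ico tb T, VectorCalculus.IsDivFree (b t)) →
      (∃ B : ℝ, ∀ t ∈ Ico tb T, ∀ x, ‖b t x‖ ≤ B) →
      (∃ T₁ ∈ Ioo tₘ T, ∀ t ∈ Ico T₁ T, ∀ x, b t x = 0) →
        ∃ G : ℝ → EuclideanSpace ℝ (Fin 3) → ℝ,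
          IsAdaptedBackwardKernel ν b (Ico tₘ T) T x₀ G ∧
          ∃ K a : ℝ, 0 < a ∧ ∀ t ∈ Ioo tₘ T, ∀ x,
            G t x ≤ K * (T - t) ^ (-(3:ℝ) / 2) * Real.exp (-(‖x - x₀‖ ^ 2) / (a * (T - t))))
    (h5 : ∀ (ν c₁ c₂ C₁ C₂ tₘ t₀ T : ℝ) (b : ℝ → EuclideanSpace ℝ (Fin 3) → EuclideanSpace ℝ (Fin 3))
      (x₀ : EuclideanSpace ℝ (Fin 3)),
      0 < ν → 0 < c₁ → 0 < c₂ → 0 < C₁ → 0 < C₂ → tₘ < t₀ → t₀ < T →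
      IsSmoothSpaceTimeOn (Ico tₘ T) b →
      (∀ T' : ℝ, t₀ < T' → T' < T →
        ∃ (b' : ℝ → EuclideanSpace ℝ (Fin 3) → EuclideanSpace ℝ (Fin 3))
          (G' : ℝ → EuclideanSpace ℝ (Fin 3) → ℝ),
          (∀ t ∈ Icc tₘ T', b' t = b t) ∧ IsAdaptedBackwardKernel ν b' (Ico tₘ T) T x₀ G' ∧
          (∀ t ∈ Ioo tₘ T, ∀ x,
            c₁ * (T - t) ^ (-(3:ℝ) / 2) * Real.exp (-(‖x - x₀‖ ^ 2) / (c₂ * (T - t))) ≤ G' t x) ∧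
          (∀ t ∈ Ioo tₘ T, ∀ x,
            G' t x ≤ C₁ * (T - t) ^ (-(3:ℝ) / 2) * Real.exp (-(‖x - x₀‖ ^ 2) / (C₂ * (T - t))))) →
      ∃ G : ℝ → EuclideanSpace ℝ (Fin 3) → ℝ,
        IsAdaptedBackwardKernel ν b (Ico t₀ T) T x₀ G ∧
        (∀ t ∈ Ico t₀ T, ∀ x,
          c₁ * (T - t) ^ (-(3:ℝ) / 2) * Real.exp (-(‖x - x₀‖ ^ 2) / (c₂ * (T - t))) ≤ G t x) ∧
        (∀ t ∈ Ico t₀ T, ∀ x,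
          G t x ≤ C₁ * (T - t) ^ (-(3:ℝ) / 2) * Real.exp (-(‖x - x₀‖ ^ 2) / (C₂ * (T - t))))) :
    ∀ (ν C : ℝ), 0 < ν → 0 ≤ C → ∃ c₁ c₂ C₁ C₂ : ℝ, 0 < c₁ ∧ 0 < c₂ ∧ 0 < C₁ ∧ 0 < C₂ ∧
      ∀ (tb t₀ T : ℝ) (b : ℝ → EuclideanSpace ℝ (Fin 3) → EuclideanSpace ℝ (Fin 3))
        (x₀ : EuclideanSpace ℝ (Fin 3)), tb < t₀ → t₀ < T →
        IsSmoothSpaceTimeOn (Ico tb T) b →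
        (∀ t ∈ Ico tb T, VectorCalculus.IsDivFree (b t)) →
        (∀ t ∈ Ico tb T, ∀ x, ‖b t x‖ ≤ C / Real.sqrt (T - t)) →
        ∃ G : ℝ → EuclideanSpace ℝ (Fin 3) → ℝ,
          IsAdaptedBackwardKernel ν b (Ico t₀ T) T x₀ G ∧
          (∀ t ∈ Ico t₀ T, ∀ x,
            c₁ * (T - t) ^ (-(3:ℝ) / 2) * Real.exp (-(‖x - x₀‖ ^ 2) / (c₂ * (T - t))) ≤ G t x) ∧
          (∀ t ∈ Ico t₀ T, ∀ x,
            G t x ≤ C₁ * (T - t) ^ (-(3:ℝ) / 2) * Real.exp (-(‖x - x₀‖ ^ 2) / (C₂ * (T - t)))) := by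
  intro ν C hν hC
  obtain ⟨C₁, C₂, hC₁, hC₂, hup⟩ := h2 ν C hν hC
  obtain ⟨c₁, c₂, hc₁, hc₂, hlow⟩ := h3 ν C C₁ C₂ hν hC hC₁ hC₂
  refine ⟨c₁, c₂, C₁, C₂, hc₁, hc₂, hC₁, hC₂, fun tb t₀ T b x₀ htb ht₀ hsm hdiv hrate => ?_⟩
  -- the middle level
  set tₘ : ℝ := (tb + t₀) / 2 with htₘ_def
  have htbₘ : tb < tₘ := by rw [htₘ_def]; linarith
  have htₘ₀ : tₘ < t₀ := by rw [htₘ_def]; linarith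
  have htₘT : tₘ < T := htₘ₀.trans ht₀
  have hsubₘ : Ico tₘ T ⊆ Ico tb T := Ico_subset_Ico_left htbₘ.le
  refine h5 ν c₁ c₂ C₁ C₂ tₘ t₀ T b x₀ hν hc₁ hc₂ hC₁ hC₂ htₘ₀ ht₀ (hsm.mono hsubₘ) ?_
  intro T' hT'₀ hT'T
  obtain ⟨b', hsm', hdiv', hrate', hagree, hB, T₁, hT₁, hvan⟩ :=
    exists_typeI_cutoff hC hsm hdiv hrate (htbₘ.trans (htₘ₀.trans hT'₀)) hT'T
  have hT₁' : T₁ ∈ Ioo tₘ T := ⟨htₘ₀.trans (hT'₀.trans hT₁.1), hT₁.2⟩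
  obtain ⟨G', hK', henv'⟩ :=
    h4 ν tb tₘ T b' x₀ hν htbₘ htₘT hsm' hdiv' hB ⟨T₁, hT₁', hvan⟩
  have hsmₘ : IsSmoothSpaceTimeOn (Ico tₘ T) b' := hsm'.mono hsubₘ
  have hdivₘ : ∀ t ∈ Ico tₘ T, VectorCalculus.IsDivFree (b' t) := fun t ht => hdiv' t (hsubₘ ht)
  have hrateₘ : ∀ t ∈ Ico tₘ T, ∀ x, ‖b' t x‖ ≤ C / Real.sqrt (T - t) :=
    fun t ht x => hrate' t (hsubₘ ht) x
  have hmom := h1 ν C tₘ T b' x₀ G' hν hC htₘT hsmₘ hdivₘ hrateₘ hK' henv'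
  have hU := hup tₘ T b' x₀ G' htₘT hsmₘ hdivₘ hrateₘ hK' henv' hmom
  have hL := hlow tₘ T b' x₀ G' htₘT hsmₘ hdivₘ hrateₘ hK' hU
  refine ⟨b', G', fun t ht => hagree t ⟨htbₘ.le.trans ht.1, ht.2.trans_lt hT'T⟩ ht.2, hK', hL, hU⟩

/-- **Composition of the line — the crux from the five stubs** (kernel-checked; no `sorry` of its
own, it inherits the stubs' `sorryAx` until they are proved).  The linear theorem
`linearTypeIDriftKernel_of stub_expMoment … stub_kernelLimit` is TRANSFERRED to the crux verbatim:
with the Type-I window `(t₁, T)` of `IsTypeIBlowup`, take `tb := max (T/4) ((3t₁+T)/4)` and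
`t₀ := max (T/2) ((t₁+T)/2)` (`0 < tb < t₀ < T`, `Ico tb T ⊆ Ioo t₁ T ∩ Ico 0 T`), constant
`max C 0`, smoothness and `div u = 0` on `[tb, T)` from `IsClassicalNSSolutionOn`; the five kernel
clauses / the comparability clause of the crux are the fields of `IsAdaptedBackwardKernel` / the
two explicit Gaussian bounds.  This theorem concludes
`Summit.NavierStokesRegularity.NavierStokesRegularity.Theses.AdaptedFrequency.AdaptedKernelExists`
BY NAME. -/
theorem AdaptedKernelExists_of :
    Summit.NavierStokesRegularity.NavierStokesRegularity.Theses.AdaptedFrequency.AdaptedKernelExists := by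
  have hlin := linearTypeIDriftKernel_of stub_expMoment stub_upperOfMoments stub_lowerOfUpper
    stub_cauchyKernel stub_kernelLimit
  intro ν T hν hT u p hns _hLH _hdec hTI x₀
  obtain ⟨C, hC⟩ := hTI
  obtain ⟨t₁, ht₁T, ht₁⟩ := mem_nhdsLT_iff_exists_Ioo_subset.1 hC
  have ht₁T' : t₁ < T := ht₁T
  set t₀ : ℝ := max (T / 2) ((t₁ + T) / 2) with ht₀_def
  set tb : ℝ := max (T / 4) ((3 * t₁ + T) / 4) with htb_def
  have htb0 : 0 ≤ tb := le_trans (by linarith) (le_max_left _ _)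
  have ht₀0 : 0 ≤ t₀ := le_trans (by linarith) (le_max_left _ _)
  have ht₀T : t₀ < T := max_lt (by linarith) (by linarith)
  have htb₀ : tb < t₀ := max_lt_max (by linarith) (by linarith)
  have hwin : ∀ t ∈ Ico tb T, t ∈ Ioo t₁ T := fun t ht =>
    ⟨lt_of_lt_of_le (by linarith [le_max_right (T / 4) ((3 * t₁ + T) / 4)]) ht.1, ht.2⟩
  have hsub : Ico tb T ⊆ Ico 0 T := Ico_subset_Ico_left htb0
  have hsm : IsSmoothSpaceTimeOn (Ico tb T) u := hns.smooth_velocity.mono hsub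
  have hdiv : ∀ t ∈ Ico tb T, VectorCalculus.IsDivFree (u t) := fun t ht => hns.divFree t (hsub ht)
  have hrate : ∀ t ∈ Ico tb T, ∀ x, ‖u t x‖ ≤ max C 0 / Real.sqrt (T - t) := by
    intro t ht x
    have h1 : ‖u t x‖ ≤ C / Real.sqrt (T - t) := ht₁ (hwin t ht) x
    exact h1.trans (div_le_div_of_nonneg_right (le_max_left _ _) (Real.sqrt_nonneg _))
  obtain ⟨c₁, c₂, C₁, C₂, hc₁, hc₂, hC₁, hC₂, hall⟩ := hlin ν (max C 0) hν (le_max_right _ _)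
  obtain ⟨G, hK, hL, hU⟩ := hall tb t₀ T u x₀ htb₀ ht₀T hsm hdiv hrate
  refine ⟨t₀, ⟨ht₀0, ht₀T⟩, G, ⟨hK.contDiffOn, hK.pos, hK.adjoint_eq, hK.integral_eq_one,
    hK.tendsto_integral_mul⟩, c₁, c₂, C₁, C₂, hc₁, hc₂, hC₁, hC₂, fun t ht x => ⟨hL t ht x, hU t ht x⟩⟩

/-! ### Sanity lemma (sorry-free): non-vacuity / calibration on the model case `b ≡ 0` -/

/-- Non-vacuity / calibration on the model case `b ≡ 0`: the zero field is a smooth,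
divergence-free Type-I drift with `C = 0`, bounded and vanishing near `T` (so it satisfies the
hypotheses of `stub_cauchyKernel`), and the backward heat kernel is an adapted kernel of it on
`Ico t₀ T` satisfying both explicit bounds with `c₁ = C₁ = (4πν)^{-3/2}`, `c₂ = C₂ = 4ν` (hence an
envelope). -/
theorem model_case {ν t₀ T : ℝ} (hν : 0 < ν) (x₀ : EuclideanSpace ℝ (Fin 3)) :
    IsSmoothSpaceTimeOn (Ico t₀ T) (0 : ℝ → EuclideanSpace ℝ (Fin 3) → EuclideanSpace ℝ (Fin 3)) ∧
    (∀ t ∈ Ico t₀ T,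
      VectorCalculus.IsDivFree ((0 : ℝ → EuclideanSpace ℝ (Fin 3) → EuclideanSpace ℝ (Fin 3)) t)) ∧
    (∀ t ∈ Ico t₀ T, ∀ x : EuclideanSpace ℝ (Fin 3),
      ‖(0 : ℝ → EuclideanSpace ℝ (Fin 3) → EuclideanSpace ℝ (Fin 3)) t x‖ ≤ 0 / Real.sqrt (T - t)) ∧
    IsAdaptedBackwardKernel ν 0 (Ico t₀ T) T x₀ (backwardHeatKernel ν T x₀) ∧
    (∀ t ∈ Ico t₀ T, ∀ x,
      (4 * Real.pi * ν) ^ (-(3 : ℝ) / 2) * (T - t) ^ (-(3:ℝ) / 2) *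
          Real.exp (-(‖x - x₀‖ ^ 2) / ((4 * ν) * (T - t))) ≤ backwardHeatKernel ν T x₀ t x) ∧
    (∀ t ∈ Ico t₀ T, ∀ x,
      backwardHeatKernel ν T x₀ t x ≤ (4 * Real.pi * ν) ^ (-(3 : ℝ) / 2) * (T - t) ^ (-(3:ℝ) / 2) *
          Real.exp (-(‖x - x₀‖ ^ 2) / ((4 * ν) * (T - t)))) := by
  refine ⟨contDiffOn_const, fun t _ x => by simp [VectorCalculus.divergence], fun t _ x => by simp,
    isAdaptedBackwardKernel_backwardHeatKernel_Ico hν t₀ T x₀, fun t ht x => ?_, fun t ht x => ?_⟩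
  · have h := backwardHeatKernel_eq hν.le x₀ (show t < T from ht.2) x
    rw [finrank_euclideanSpace_fin] at h
    rw [h]
    norm_num
  · have h := backwardHeatKernel_eq hν.le x₀ (show t < T from ht.2) x
    rw [finrank_euclideanSpace_fin] at h
    rw [h]
    norm_num

end Summit.NavierStokesRegularity.NavierStokesRegularity.Cruxes.AdaptedKernelExists.NashEntropyLastBlock

end
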